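import Mathlib
import Summits.ValiantsHypothesis.ValiantsHypothesis.Theorems.SymPencilSymmetrizePermPairsPermEmbeddingDSubS
import Summits.ValiantsHypothesis.ValiantsHypothesis.Theorems.SymPencilSymmetrizePermPairsProjectionsAlternating
import Summits.ValiantsHypothesis.ValiantsHypothesis.Theorems.SymPencilSymmetrizePermPairsPermifySubgroup
import HarnessLib

/-!
# ValiantsHypothesis / SymPencil — crux `SymmetrizePermPairs` (stmt-ValiantsHypothesis-17793),
# stub `stub_induce`, ASSEMBLY [A5]: the `permify_subgroup` branch UNCONDITIONALLY

Wiring of the landed pieces: (GS) = `SmallIndex.prod_altFixing_le_of_small_index` at `α = Fin n`;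
(D)_H = `permEmbeddingD_sub_of_GS` (symmetric-core route: `SmallIndex.exists_symmetric_core`,
`SpinDichotomy.spinDichotomy_two_degree`, `YoungBounds.youngFixedVector_two_holds`);
`permify_subgroup_of_D` ((i)/(ii)_sub, (iii″)_H, (iv)).  Results:

* `permEmbeddingD_sub_holds` — (D)_H: every irreducible representation `ρ : G → GL_k(ℂ)` of a finite
  group `G → 𝔖_n × 𝔖_n` (image of index `R`), scalar with `M`-th roots of unity on the kernel,
  `k ≤ M`, is an equivariant retract of a permutation representation of size
  `≤ 2^{(log₂ M + log₂ n + log₂ R + d)^d}`;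
* `permify_subgroup_holds` — for every `H ≤ 𝔖_n × 𝔖_n` and every affine determinantal representation
  `A` of `per_n` of size `m`, equivariant (exact `GL_m × GL_m` lifts) under the permutation matrices
  of the pairs of `H`: an affine pencil `A'` of size `m' ≤ 2^{(log₂ m + log₂ [𝔖_n² : H] + d)^d}` with
  `det A' = per_n` and `A'(x_{π i, ρ j}) = P_σ A'(x) P_σᵀ` for every `(π, ρ) ∈ H`.

Honest framing: this is the `permify_subgroup` branch of the tenure's cut
(`stub_induce ⇐ induce_blocks (I1) ∧ permify_subgroup ∧ symmetrize_equivariant (C3)`), now a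
theorem; the induced-block step (I1) and the symmetric/`Γ_n`-equivariant output (C3) are NOT here,
so `stub_induce`, the crux `SymmetrizePermPairs` and `VP ≠ VNP` remain OPEN and nothing here is
progress on `VP ≠ VNP`.  No new definitions, no named facts
(`--supports stmt-ValiantsHypothesis-17793 --as helper`).
-/

noncomputable section

-- `Summit.ValiantsHypothesis.ValiantsHypothesis.…` is the tree's mandated single-conjunct layout
-- (Sub = Summit), so the duplicated namespace component is intended.
set_option linter.dupNamespace false

namespace Summit.ValiantsHypothesis.ValiantsHypothesis.Theorems.SymPencilEquivariantSdcNotQP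

open Literature.Computability.AlgebraicComplexity MvPolynomial Matrix Equiv Equiv.Perm

/-- **(D)_H holds.**  `permEmbeddingD_sub_of_GS` with (GS) discharged by
`SmallIndex.prod_altFixing_le_of_small_index` (Dixon–Mortimer 5.2B for both projections + the
Goursat dichotomy) at `α = Fin n`. [folklore] -/
theorem permEmbeddingD_sub_holds :
    ∃ d : ℕ, ∀ (n M k : ℕ) (G : Type) [Group G] [Finite G]
      (φ : G →* Perm (Fin n) × Perm (Fin n)) (ρ : G →* GL (Fin k) ℂ),
      (∀ g : G, φ g = 1 → ∃ c : ℂ, c ^ M = 1 ∧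
        (ρ g : Matrix (Fin k) (Fin k) ℂ) = c • (1 : Matrix (Fin k) (Fin k) ℂ)) →
      k ≤ M →
      (∀ W : Submodule ℂ (Fin k → ℂ),
        (∀ g : G, W ≤ W.comap (Matrix.toLin' (ρ g : Matrix (Fin k) (Fin k) ℂ))) → W = ⊥ ∨ W = ⊤) →
      ∃ m' ≤ 2 ^ ((Nat.log 2 M + Nat.log 2 n + Nat.log 2 φ.range.index + d) ^ d),
        ∃ (ι : Matrix (Fin m') (Fin k) ℂ) (p : Matrix (Fin k) (Fin m') ℂ) (τ : G → Perm (Fin m')),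
          p * ι = 1 ∧ ∀ g : G,
            (τ g).permMatrix ℂ * ι = ι * (ρ g : Matrix (Fin k) (Fin k) ℂ) ∧
            p * (τ g).permMatrix ℂ = (ρ g : Matrix (Fin k) (Fin k) ℂ) * p :=
  permEmbeddingD_sub_of_GS fun n I k₀ hn hk h4k hidx hidx2 =>
    SmallIndex.prod_altFixing_le_of_small_index I k₀ (by rw [Fintype.card_fin]; exact hn) hk
      (by rw [Fintype.card_fin]; exact h4k) (by rw [Fintype.card_fin]; exact hidx)
      (by rw [Fintype.card_fin]; exact hidx2)

/-- **The `permify_subgroup` branch of `stub_induce`, unconditionally.**  For every subgroup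
`H ≤ 𝔖_n × 𝔖_n` and every affine determinantal representation `A` of `per_n` of size `m`, equivariant
(exact `GL_m × GL_m` lifts, tree `IsEquivariantDetRepr`) under the closure of the permutation
matrices of the pairs of `H`, there is an affine pencil `A'` of size
`m' ≤ 2^{(log₂ m + log₂ [𝔖_n × 𝔖_n : H] + d)^d}` with `det A' = per_n` on which every substitution
`x_{ij} ↦ x_{π i, ρ j}`, `(π, ρ) ∈ H`, acts by conjugation with a PERMUTATION matrix.
(`permify_subgroup_of_D permEmbeddingD_sub_holds`.)  Not `stub_induce`: the output is `H`-permified,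
neither `Γ_n`-equivariant nor symmetric. [folklore] -/
theorem permify_subgroup_holds :
    ∃ d : ℕ, ∀ (n m : ℕ) (H : Subgroup (Perm (Fin n) × Perm (Fin n)))
      (A : Matrix (Fin m) (Fin m) (MvPolynomial (Fin n × Fin n) ℂ)),
      IsEquivariantDetRepr (Subgroup.closure {γ : GL (Fin n × Fin n) ℂ |
        ∃ πρ ∈ H, (γ : Matrix (Fin n × Fin n) (Fin n × Fin n) ℂ) =
          Equiv.Perm.permMatrix ℂ (Equiv.prodCongr πρ.1 πρ.2)}) (perPoly (Fin n) ℂ) A →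
      ∃ m' ≤ 2 ^ ((Nat.log 2 m + Nat.log 2 H.index + d) ^ d),
        ∃ A' : Matrix (Fin m') (Fin m') (MvPolynomial (Fin n × Fin n) ℂ),
          IsAffineDetRepr (perPoly (Fin n) ℂ) A' ∧
          ∀ πρ ∈ H, ∃ σ : Perm (Fin m'),
            A'.map (MvPolynomial.rename fun ij : Fin n × Fin n => (πρ.1 ij.1, πρ.2 ij.2)) =
              (σ.permMatrix ℂ).map MvPolynomial.C * A' * ((σ.permMatrix ℂ)ᵀ).map MvPolynomial.C :=
  permify_subgroup_of_D permEmbeddingD_sub_holds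

end Summit.ValiantsHypothesis.ValiantsHypothesis.Theorems.SymPencilEquivariantSdcNotQP

end
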